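import Mathlib
import Summits.AtomisticToContinuum.FouriersLaw.Theorems.EmbeddedDrudeMourreDrudeDissolutionOmegaStructureBounds
import Summits.AtomisticToContinuum.FouriersLaw.Theorems.EmbeddedDrudeMourreDrudeDissolutionWeightFactorisation
import HarnessLib

/-!
# Structure bounds for the excursion weight `W = (S₁S₂)²·B̃`
(crux `EmbeddedDrudeMourre.DrudeDissolution`, item stmt-AtomisticToContinuum-12593; `--supports` file for the
registered sub-goal `weight_structure_bounds` of stub B1b″ `stub_excursionSecondDifference` of line
`kinetic-polymer-gas-on-the-time-axis`; closes nothing; lead c13 (process B), 2026-08-17)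

WHAT. Abstract (`weight_structure_pointwise`): if `W = (S₁S₂)²·B` with `C²` factors, `|Sᵢ| ≤ 1`, the first and
second derivatives of `Sᵢ` along two directions `u, v` bounded by `1`, and `|B|, |∂B|, |∂ᵥ∂ᵤB| ≤ C` at `p`, then
with `x = |S₁ p|`, `y = |S₂ p|`:
`|W p| ≤ C x²y²`, `|∂ᵤW (p)| ≤ 3C·xy(x+y)`, `|∂ᵥ∂ᵤW (p)| ≤ 13C·(x²+y²)`.
Concrete (`weight_structure_bounds`, registered): for the excursion weight of a sine polynomial profile and any
admissible frame (`|(e i)₃−(e i)₁|, |(e i)₃−(e i)₂| ≤ 1`), some `C_W ≥ 0` bounds `W`, `∂_{eᵢ}W`, `∂_{eⱼ}∂_{eᵢ}W`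
in exactly these shapes at every point (`weight_factorisation` + `halfSine_direction_bounds`).

WHY (role). The inputs `g₀ ≲ x²y²`, `g₁ ≲ xy(x+y) + …`, `g₂ ≲ x²+y² + …` of `supBound_curve_algebra` in the
sup-norm route (item (C2-W)/(C6) of the remaining concrete work for B1b″).
-/

noncomputable section

open scoped Topology
open Filter Set

namespace Summit.AtomisticToContinuum.FouriersLaw.Theorems.DrudeDissolution.KineticPolymerGasOnTheTimeAxis

open Literature.MathematicalPhysics.KineticTheory
open Literature.MathematicalPhysics.KineticTheory.PhononBoltzmann

/-! ### The abstract pointwise bounds -/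

/-- **Structure bounds for `W = (S₁S₂)²·B` at a point.** See the module docstring. [folklore] -/
theorem weight_structure_pointwise {V : Type*} [NormedAddCommGroup V] [NormedSpace ℝ V]
    {S₁ S₂ B W : V → ℝ} (h1 : ContDiff ℝ 2 S₁) (h2 : ContDiff ℝ 2 S₂) (hB : ContDiff ℝ 2 B)
    (hW : W = fun q => (S₁ q * S₂ q) ^ 2 * B q) (u v p : V) {C : ℝ} (hC : 0 ≤ C)
    (bS₁ : |S₁ p| ≤ 1) (bS₂ : |S₂ p| ≤ 1) (bS₁u : |fderiv ℝ S₁ p u| ≤ 1) (bS₁v : |fderiv ℝ S₁ p v| ≤ 1)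
    (bS₂u : |fderiv ℝ S₂ p u| ≤ 1) (bS₂v : |fderiv ℝ S₂ p v| ≤ 1)
    (bS₁uv : |fderiv ℝ (fun q => fderiv ℝ S₁ q u) p v| ≤ 1) (bS₂uv : |fderiv ℝ (fun q => fderiv ℝ S₂ q u) p v| ≤ 1)
    (bB : |B p| ≤ C) (bBu : |fderiv ℝ B p u| ≤ C) (bBv : |fderiv ℝ B p v| ≤ C)
    (bBuv : |fderiv ℝ (fun q => fderiv ℝ B q u) p v| ≤ C) :
    |W p| ≤ C * (S₁ p ^ 2 * S₂ p ^ 2) ∧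
      |fderiv ℝ W p u| ≤ 3 * C * (|S₁ p * S₂ p| * (|S₁ p| + |S₂ p|)) ∧
      |fderiv ℝ (fun q => fderiv ℝ W q u) p v| ≤ 13 * C * (S₁ p ^ 2 + S₂ p ^ 2) := by
  -- differentiability
  have d1 : Differentiable ℝ S₁ := h1.differentiable (by norm_num)
  have d2 : Differentiable ℝ S₂ := h2.differentiable (by norm_num)
  have dB : Differentiable ℝ B := hB.differentiable (by norm_num)
  obtain ⟨U, hUdef⟩ : ∃ U : V → ℝ, U = fun q => S₁ q * S₂ q := ⟨_, rfl⟩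
  have hU2 : ContDiff ℝ 2 U := by rw [hUdef]; exact h1.mul h2
  have dU : Differentiable ℝ U := hU2.differentiable (by norm_num)
  obtain ⟨s₁, hs₁def⟩ : ∃ s₁ : V → ℝ, s₁ = fun q => fderiv ℝ S₁ q u := ⟨_, rfl⟩
  obtain ⟨s₂, hs₂def⟩ : ∃ s₂ : V → ℝ, s₂ = fun q => fderiv ℝ S₂ q u := ⟨_, rfl⟩
  obtain ⟨U', hU'def⟩ : ∃ U' : V → ℝ, U' = fun q => fderiv ℝ U q u := ⟨_, rfl⟩
  obtain ⟨B', hB'def⟩ : ∃ B' : V → ℝ, B' = fun q => fderiv ℝ B q u := ⟨_, rfl⟩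
  rw [← hs₁def] at bS₁uv
  rw [← hs₂def] at bS₂uv
  rw [← hB'def] at bBuv
  have ds₁ : Differentiable ℝ s₁ := by
    rw [hs₁def]; exact ((h1.fderiv_right (m := 1) (by norm_num)).clm_apply contDiff_const).differentiable one_ne_zero
  have ds₂ : Differentiable ℝ s₂ := by
    rw [hs₂def]; exact ((h2.fderiv_right (m := 1) (by norm_num)).clm_apply contDiff_const).differentiable one_ne_zero
  have dU' : Differentiable ℝ U' := by
    rw [hU'def]; exact ((hU2.fderiv_right (m := 1) (by norm_num)).clm_apply contDiff_const).differentiable one_ne_zero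
  have dB' : Differentiable ℝ B' := by
    rw [hB'def]; exact ((hB.fderiv_right (m := 1) (by norm_num)).clm_apply contDiff_const).differentiable one_ne_zero
  -- function identities
  have hWU : W = fun q => U q * U q * B q := by rw [hW, hUdef]; funext q; ring
  have hU' : U' = fun q => s₁ q * S₂ q + S₁ q * s₂ q := by
    rw [hU'def, hs₁def, hs₂def, hUdef]; funext q; exact fp_mul (d1 q) (d2 q) u
  have hW' : (fun q => fderiv ℝ W q u) = fun q => U' q * U q * B q + U q * U' q * B q + U q * U q * B' q := by
    funext q; rw [hWU, hU'def, hB'def]; exact fp_mul3 (dU q) (dU q) (dB q) u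
  -- sizes at `p`
  obtain ⟨x, hx⟩ : ∃ x : ℝ, x = |S₁ p| := ⟨_, rfl⟩
  obtain ⟨y, hy⟩ : ∃ y : ℝ, y = |S₂ p| := ⟨_, rfl⟩
  rw [← hx] at bS₁
  rw [← hy] at bS₂
  have hx0 : 0 ≤ x := by rw [hx]; exact abs_nonneg _
  have hy0 : 0 ≤ y := by rw [hy]; exact abs_nonneg _
  have hUp : |U p| = x * y := by rw [hUdef]; simp only [abs_mul, hx, hy]
  have hs₁p : |s₁ p| ≤ 1 := by rw [hs₁def]; exact bS₁u
  have hs₂p : |s₂ p| ≤ 1 := by rw [hs₂def]; exact bS₂u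
  have hB'p : |B' p| ≤ C := by rw [hB'def]; exact bBu
  have hU'p : |U' p| ≤ x + y := by
    rw [hU']
    calc |s₁ p * S₂ p + S₁ p * s₂ p| ≤ |s₁ p * S₂ p| + |S₁ p * s₂ p| := abs_add_le _ _
      _ = |s₁ p| * y + x * |s₂ p| := by rw [abs_mul, abs_mul, hx, hy]
      _ ≤ 1 * y + x * 1 := by gcongr
      _ = x + y := by ring
  have hUv : |fderiv ℝ U p v| ≤ x + y := by
    have : fderiv ℝ U p v = fderiv ℝ S₁ p v * S₂ p + S₁ p * fderiv ℝ S₂ p v := by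
      rw [hUdef]; exact fp_mul (d1 p) (d2 p) v
    rw [this]
    calc |fderiv ℝ S₁ p v * S₂ p + S₁ p * fderiv ℝ S₂ p v|
        ≤ |fderiv ℝ S₁ p v * S₂ p| + |S₁ p * fderiv ℝ S₂ p v| := abs_add_le _ _
      _ = |fderiv ℝ S₁ p v| * y + x * |fderiv ℝ S₂ p v| := by rw [abs_mul, abs_mul, hx, hy]
      _ ≤ 1 * y + x * 1 := by gcongr
      _ = x + y := by ring
  have hU'v : |fderiv ℝ U' p v| ≤ 4 := by
    have e : fderiv ℝ U' p v = fderiv ℝ s₁ p v * S₂ p + s₁ p * fderiv ℝ S₂ p v +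
        (fderiv ℝ S₁ p v * s₂ p + S₁ p * fderiv ℝ s₂ p v) := by
      have dA1 : DifferentiableAt ℝ (fun q => s₁ q * S₂ q) p := (ds₁ p).mul (d2 p)
      have dA2 : DifferentiableAt ℝ (fun q => S₁ q * s₂ q) p := (d1 p).mul (ds₂ p)
      rw [hU', fderiv_fun_add dA1 dA2]
      simp only [add_apply]
      rw [fp_mul (ds₁ p) (d2 p), fp_mul (d1 p) (ds₂ p)]
    rw [e]
    have bS₁' : |S₁ p| ≤ 1 := by rw [← hx]; exact bS₁
    have bS₂' : |S₂ p| ≤ 1 := by rw [← hy]; exact bS₂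
    have b1 : |fderiv ℝ s₁ p v * S₂ p| ≤ 1 := by
      rw [abs_mul]; exact mul_le_one₀ bS₁uv (abs_nonneg _) bS₂'
    have b2 : |s₁ p * fderiv ℝ S₂ p v| ≤ 1 := by
      rw [abs_mul]; exact mul_le_one₀ hs₁p (abs_nonneg _) bS₂v
    have b3 : |fderiv ℝ S₁ p v * s₂ p| ≤ 1 := by
      rw [abs_mul]; exact mul_le_one₀ bS₁v (abs_nonneg _) hs₂p
    have b4 : |S₁ p * fderiv ℝ s₂ p v| ≤ 1 := by
      rw [abs_mul]; exact mul_le_one₀ bS₁' (abs_nonneg _) bS₂uv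
    calc _ ≤ |fderiv ℝ s₁ p v * S₂ p + s₁ p * fderiv ℝ S₂ p v| + |fderiv ℝ S₁ p v * s₂ p + S₁ p * fderiv ℝ s₂ p v| :=
          abs_add_le _ _
      _ ≤ (|fderiv ℝ s₁ p v * S₂ p| + |s₁ p * fderiv ℝ S₂ p v|) +
          (|fderiv ℝ S₁ p v * s₂ p| + |S₁ p * fderiv ℝ s₂ p v|) := add_le_add (abs_add_le _ _) (abs_add_le _ _)
      _ ≤ (1 + 1) + (1 + 1) := by gcongr
      _ = 4 := by norm_num
  have hx1 : x ≤ 1 := bS₁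
  have hy1 : y ≤ 1 := bS₂
  have hxy : 0 ≤ x * y := mul_nonneg hx0 hy0
  -- elementary comparisons on `[0,1]²`
  have c1 : x * y ≤ (x ^ 2 + y ^ 2) / 2 := by nlinarith [sq_nonneg (x - y)]
  have c2 : (x + y) ^ 2 ≤ 2 * (x ^ 2 + y ^ 2) := by nlinarith [sq_nonneg (x - y)]
  have c3 : x * y * (x + y) ≤ x ^ 2 + y ^ 2 := by nlinarith
  have c4 : x ^ 2 * y ^ 2 ≤ (x ^ 2 + y ^ 2) / 2 := by nlinarith [mul_le_one₀ hx1 hy0 hy1]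
  have c5 : x ^ 2 * y ^ 2 ≤ x * y * (x + y) := by nlinarith [mul_le_one₀ hx1 hy0 hy1]
  have hxy' : 0 ≤ x + y := add_nonneg hx0 hy0
  have mm : ∀ {a₀ b₀ c₀ A₀ B₀ C₀ : ℝ}, |a₀| ≤ A₀ → |b₀| ≤ B₀ → |c₀| ≤ C₀ → 0 ≤ A₀ → 0 ≤ B₀ →
      |a₀ * b₀ * c₀| ≤ A₀ * B₀ * C₀ := fun ha hb hc hA hB0 => by
    rw [abs_mul, abs_mul]
    exact mul_le_mul (mul_le_mul ha hb (abs_nonneg _) hA) hc (abs_nonneg _) (mul_nonneg hA hB0)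
  have h4 : (0 : ℝ) ≤ 4 := by norm_num
  refine ⟨?_, ?_, ?_⟩
  · -- order 0
    rw [hWU]; simp only
    rw [abs_mul, abs_mul, hUp]
    calc x * y * (x * y) * |B p| ≤ x * y * (x * y) * C := mul_le_mul_of_nonneg_left bB (mul_nonneg hxy hxy)
      _ = C * (S₁ p ^ 2 * S₂ p ^ 2) := by rw [← sq_abs (S₁ p), ← sq_abs (S₂ p), ← hx, ← hy]; ring
  · -- order 1
    have e : fderiv ℝ W p u = U' p * U p * B p + U p * U' p * B p + U p * U p * B' p := congrFun hW' p
    rw [e]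
    have t1 : |U' p * U p * B p| ≤ (x + y) * (x * y) * C := mm hU'p hUp.le bB hxy' hxy
    have t2 : |U p * U' p * B p| ≤ (x * y) * (x + y) * C := mm hUp.le hU'p bB hxy hxy'
    have t3 : |U p * U p * B' p| ≤ (x * y) * (x * y) * C := mm hUp.le hUp.le hB'p hxy hxy
    have hSS : |S₁ p * S₂ p| = x * y := by rw [abs_mul, hx, hy]
    rw [hSS, ← hx, ← hy]
    calc |U' p * U p * B p + U p * U' p * B p + U p * U p * B' p|
        ≤ |U' p * U p * B p| + |U p * U' p * B p| + |U p * U p * B' p| :=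
          (abs_add_le _ _).trans (by linarith [abs_add_le (U' p * U p * B p) (U p * U' p * B p)])
      _ ≤ (x + y) * (x * y) * C + (x * y) * (x + y) * C + (x * y) * (x * y) * C := by linarith
      _ ≤ 3 * C * (x * y * (x + y)) := by
          have h := mul_le_mul_of_nonneg_right c5 hC
          linarith
  · -- order 2
    rw [hW']
    have dA : DifferentiableAt ℝ (fun q => U' q * U q * B q) p := ((dU' p).mul (dU p)).mul (dB p)
    have dBB : DifferentiableAt ℝ (fun q => U q * U' q * B q) p := ((dU p).mul (dU' p)).mul (dB p)
    have dCC : DifferentiableAt ℝ (fun q => U q * U q * B' q) p := ((dU p).mul (dU p)).mul (dB' p)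
    have dAB : DifferentiableAt ℝ (fun q => U' q * U q * B q + U q * U' q * B q) p := dA.add dBB
    rw [fderiv_fun_add dAB dCC, fderiv_fun_add dA dBB]
    simp only [add_apply]
    rw [fp_mul3 (dU' p) (dU p) (dB p), fp_mul3 (dU p) (dU' p) (dB p), fp_mul3 (dU p) (dU p) (dB' p)]
    -- the nine terms
    have bB'v : |fderiv ℝ B' p v| ≤ C := bBuv
    have t1 : |fderiv ℝ U' p v * U p * B p| ≤ 4 * (x * y) * C := mm hU'v hUp.le bB h4 hxy
    have t2 : |U' p * fderiv ℝ U p v * B p| ≤ (x + y) * (x + y) * C := mm hU'p hUv bB hxy' hxy'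
    have t3 : |U' p * U p * fderiv ℝ B p v| ≤ (x + y) * (x * y) * C := mm hU'p hUp.le bBv hxy' hxy
    have t4 : |fderiv ℝ U p v * U' p * B p| ≤ (x + y) * (x + y) * C := mm hUv hU'p bB hxy' hxy'
    have t5 : |U p * fderiv ℝ U' p v * B p| ≤ (x * y) * 4 * C := mm hUp.le hU'v bB hxy h4
    have t6 : |U p * U' p * fderiv ℝ B p v| ≤ (x * y) * (x + y) * C := mm hUp.le hU'p bBv hxy hxy'
    have t7 : |fderiv ℝ U p v * U p * B' p| ≤ (x + y) * (x * y) * C := mm hUv hUp.le hB'p hxy' hxy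
    have t8 : |U p * fderiv ℝ U p v * B' p| ≤ (x * y) * (x + y) * C := mm hUp.le hUv hB'p hxy hxy'
    have t9 : |U p * U p * fderiv ℝ B' p v| ≤ (x * y) * (x * y) * C := mm hUp.le hUp.le bB'v hxy hxy
    have tri : ∀ a b c : ℝ, |a + b + c| ≤ |a| + |b| + |c| := fun a b c =>
      (abs_add_le _ _).trans (by linarith [abs_add_le a b])
    calc _ ≤ (|fderiv ℝ U' p v * U p * B p| + |U' p * fderiv ℝ U p v * B p| + |U' p * U p * fderiv ℝ B p v|) +
          (|fderiv ℝ U p v * U' p * B p| + |U p * fderiv ℝ U' p v * B p| + |U p * U' p * fderiv ℝ B p v|) +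
          (|fderiv ℝ U p v * U p * B' p| + |U p * fderiv ℝ U p v * B' p| + |U p * U p * fderiv ℝ B' p v|) :=
          (tri _ _ _).trans (add_le_add (add_le_add (tri _ _ _) (tri _ _ _)) (tri _ _ _))
      _ ≤ (4 * (x * y) * C + (x + y) * (x + y) * C + (x + y) * (x * y) * C) +
          ((x + y) * (x + y) * C + (x * y) * 4 * C + (x * y) * (x + y) * C) +
          ((x + y) * (x * y) * C + (x * y) * (x + y) * C + (x * y) * (x * y) * C) := by
          linarith [t1, t2, t3, t4, t5, t6, t7, t8, t9]
      _ = C * (8 * (x * y) + 2 * (x + y) ^ 2 + 4 * (x * y * (x + y)) + x ^ 2 * y ^ 2) := by ring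
      _ ≤ C * (8 * ((x ^ 2 + y ^ 2) / 2) + 2 * (2 * (x ^ 2 + y ^ 2)) + 4 * (x ^ 2 + y ^ 2) + (x ^ 2 + y ^ 2) / 2) :=
          mul_le_mul_of_nonneg_left (by linarith [c1, c2, c3, c4]) hC
      _ ≤ 13 * C * (S₁ p ^ 2 + S₂ p ^ 2) := by
          rw [← sq_abs (S₁ p), ← sq_abs (S₂ p), ← hx, ← hy]
          have := mul_nonneg hC (add_nonneg (sq_nonneg x) (sq_nonneg y))
          linarith

/-! ### The concrete bounds -/

/-- **Registered sub-goal `weight_structure_bounds` of stub B1b″ (item (C2-W)).** For `ω₂ > 0`, a sine polynomial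
profile, `S₁, S₂, W` as in `weight_factorisation`, and an admissible frame `e`: some `C_W ≥ 0` gives, at every
`p` and for all `i j`, `|W p| ≤ C_W S₁²S₂²`, `|∂_{eᵢ}W (p)| ≤ C_W |S₁S₂|(|S₁|+|S₂|)`,
`|∂_{eⱼ}∂_{eᵢ}W (p)| ≤ C_W (S₁² + S₂²)`. [folklore] -/
theorem weight_structure_bounds :
    ∀ ω₂ a b : ℝ, 0 < ω₂ → ∀ (M : ℕ) (c : Fin M → ℝ) (f : ℝ → ℝ) (S₁ S₂ W : ℝ × ℝ × ℝ → ℝ),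
      (∀ k, f k = ∑ i, c i * Real.sin (((i : ℕ) + 1 : ℕ) * k)) →
      (∀ p : ℝ × ℝ × ℝ, S₁ p = Real.sin ((p.2.1 - p.1) / 2)) →
      (∀ p : ℝ × ℝ × ℝ, S₂ p = Real.sin ((p.2.1 - p.2.2) / 2)) →
      (∀ p : ℝ × ℝ × ℝ, W p = vertex a b p.1 p.2.2 p.2.1 ^ 2 /
          (dispersion ω₂ p.1 * dispersion ω₂ p.2.2 * dispersion ω₂ p.2.1 * dispersion ω₂ (p.1 + p.2.2 - p.2.1)) ^ 2 *
        (f p.1 + f p.2.2 - f p.2.1 - f (p.1 + p.2.2 - p.2.1)) ^ 2) →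
      ∀ e : Fin 3 → ℝ × ℝ × ℝ, (∀ i, |(e i).2.1 - (e i).1| ≤ 1 ∧ |(e i).2.1 - (e i).2.2| ≤ 1) →
      ∃ CW : ℝ, 0 ≤ CW ∧ ∀ (p : ℝ × ℝ × ℝ) (i j : Fin 3),
        |W p| ≤ CW * (S₁ p ^ 2 * S₂ p ^ 2) ∧
        |fderiv ℝ W p (e i)| ≤ CW * (|S₁ p * S₂ p| * (|S₁ p| + |S₂ p|)) ∧
        |fderiv ℝ (fun q => fderiv ℝ W q (e i)) p (e j)| ≤ CW * (S₁ p ^ 2 + S₂ p ^ 2) := by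
  intro ω₂ a b hω M c f S₁ S₂ W hf hS₁ hS₂ hW e he
  obtain ⟨B, C, hC0, hfac, hB2, hBb⟩ := weight_factorisation ω₂ a b hω M c f S₁ S₂ W hf hS₁ hS₂ hW e
  have h1 : ContDiff ℝ 2 S₁ := resonance_contDiff_S₁ hS₁ 2
  have h2 : ContDiff ℝ 2 S₂ := resonance_contDiff_S₂ hS₂ 2
  have hWf : W = fun q => (S₁ q * S₂ q) ^ 2 * B q := funext hfac
  -- the two linear forms of the half-angle sines
  set L₁ : ℝ × ℝ × ℝ →L[ℝ] ℝ :=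
    (ContinuousLinearMap.fst ℝ ℝ ℝ).comp (ContinuousLinearMap.snd ℝ ℝ (ℝ × ℝ)) - ContinuousLinearMap.fst ℝ ℝ (ℝ × ℝ)
    with hL₁
  set L₂ : ℝ × ℝ × ℝ →L[ℝ] ℝ :=
    (ContinuousLinearMap.fst ℝ ℝ ℝ).comp (ContinuousLinearMap.snd ℝ ℝ (ℝ × ℝ)) -
      (ContinuousLinearMap.snd ℝ ℝ ℝ).comp (ContinuousLinearMap.snd ℝ ℝ (ℝ × ℝ)) with hL₂
  have hL₁a : ∀ q : ℝ × ℝ × ℝ, L₁ q = q.2.1 - q.1 := fun q => by simp [hL₁]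
  have hL₂a : ∀ q : ℝ × ℝ × ℝ, L₂ q = q.2.1 - q.2.2 := fun q => by simp [hL₂]
  have hS₁L : S₁ = fun q => Real.sin (L₁ q / 2) := funext fun q => by rw [hS₁, hL₁a]
  have hS₂L : S₂ = fun q => Real.sin (L₂ q / 2) := funext fun q => by rw [hS₂, hL₂a]
  refine ⟨13 * C, by positivity, fun p i j => ?_⟩
  obtain ⟨-, -, bS₁, bS₁v, bs₁, bs₁v⟩ := halfSine_direction_bounds L₁ S₁ (fun q => fderiv ℝ S₁ q (e i)) (e i) (e j) p
    hS₁L rfl (by rw [hL₁a]; exact (he i).1) (by rw [hL₁a]; exact (he j).1)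
  obtain ⟨-, -, -, bS₁u, -, -⟩ := halfSine_direction_bounds L₁ S₁ (fun q => fderiv ℝ S₁ q (e i)) (e i) (e i) p
    hS₁L rfl (by rw [hL₁a]; exact (he i).1) (by rw [hL₁a]; exact (he i).1)
  obtain ⟨-, -, bS₂, bS₂v, bs₂, bs₂v⟩ := halfSine_direction_bounds L₂ S₂ (fun q => fderiv ℝ S₂ q (e i)) (e i) (e j) p
    hS₂L rfl (by rw [hL₂a]; exact (he i).2) (by rw [hL₂a]; exact (he j).2)
  obtain ⟨-, -, -, bS₂u, -, -⟩ := halfSine_direction_bounds L₂ S₂ (fun q => fderiv ℝ S₂ q (e i)) (e i) (e i) p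
    hS₂L rfl (by rw [hL₂a]; exact (he i).2) (by rw [hL₂a]; exact (he i).2)
  obtain ⟨w0, w1, w2⟩ := weight_structure_pointwise h1 h2 hB2 hWf (e i) (e j) p hC0 bS₁ bS₂ bS₁u bS₁v bS₂u bS₂v
    bs₁v bs₂v (hBb p).1 ((hBb p).2.1 i) ((hBb p).2.1 j) ((hBb p).2.2 i j)
  have hn1 : 0 ≤ S₁ p ^ 2 * S₂ p ^ 2 := by positivity
  have hn2 : 0 ≤ |S₁ p * S₂ p| * (|S₁ p| + |S₂ p|) := by positivity
  refine ⟨w0.trans ?_, w1.trans ?_, w2⟩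
  · nlinarith
  · nlinarith

end Summit.AtomisticToContinuum.FouriersLaw.Theorems.DrudeDissolution.KineticPolymerGasOnTheTimeAxis

end
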